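import Summits.Ventures.PercRepro.ProfilePointedCircuitClassesStarSharpD0L

/-!
# PercRepro — CASE D0 OF `StarNineSharp`, PART L1: THE ENGINE OF THE OPPOSITE-VERTEX RULE
(p5, gen 54; `proofs/P5-GM1.md` §81 ADD 1)

`opp_in_coff_of_key`: for an R3 demand `π` (the swap R0 fails) whose plane holds a third point `t` of `X`, if
`ρ(π ∪ W) ≤ 3` (`W = X − π − t`) would make `π` an ON line, then `t` is an OFF C-point — because an ON line `π`
makes `π + f + b` a bi-independent ON set (the swap), and an ON `{e, f, t}` would meet the demand plane in `{e, t}`.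
-/

open scoped Matroid

namespace PercRepro.Cogirth

open Finset ThmH Skew Shadow Profile

variable {α : Type} [DecidableEq α] {N : Matroid α} [N.Finite]

section StarSharpD0L1

variable {b b' : α}

/-- **THE OPPOSITE VERTEX IS AN OFF C-POINT** (the engine of L1 and L3): for an R3 demand `π` (R0 fails) whose plane
holds a third point `t` of `X`, if `ρ(π ∪ W) ≤ 3` (`W := X − π − t`) would make `π` an ON line, then `t` is an OFF
C-point. -/
theorem opp_in_coff_of_key (h : SeriesPair N b b') (hn : (gr N).card = 9) (hR : rk N (gr N) = 5) {e f : α}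
    (hnle : ∀ S : Finset α, S ⊆ ((gr N).erase b).erase b' → e ∈ S → rk N (insert b (insert b' S)) ≤ 3 → rk N S ≤ 1)
    (he : e ∈ gr N) (hf : f ∈ gr N) (hef : e ≠ f) (heb : e ≠ b) (heb' : e ≠ b') (hfb : f ≠ b) (hfb' : f ≠ b')
    (hE7 : rk N (((gr N).erase b).erase b') = 4)
    (he1 : ∀ y ∈ ((((gr N).erase b).erase b').erase f).erase e, rk N {e, y} = 2)
    (hX : rk N (((((gr N).erase b).erase b').erase f).erase e) = 4)
    {π : Finset α} (hπ : π ⊆ ((((gr N).erase b).erase b').erase f).erase e) (hπ2 : π.card = 2)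
    (hY : rk N (insert e π) = 3) (hYon : rk N (insert b (insert b' (insert e π))) = 4)
    (hef4 : rk N (insert f (insert e π)) = 4)
    (hYc : rk N (insert f (((((gr N).erase b).erase b').erase f).erase e \ π)) = 4)
    (hcon : rk N (insert b (insert b' (((((gr N).erase b).erase b').erase f).erase e \ π))) = 4)
    (hR0 : ¬ (rk N (insert f π) = 3 ∧ rk N (insert e (((((gr N).erase b).erase b').erase f).erase e \ π)) = 4 ∧
      rk N (insert b (insert b' (insert f π))) = 4))
    {t : α} (ht : t ∈ ((((gr N).erase b).erase b').erase f).erase e \ π) (htH : rk N (insert t (insert e π)) = 3)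
    (hkey : rk N (π ∪ (((((gr N).erase b).erase b').erase f).erase e \ π).erase t) ≤ 3 → rk N (insert b (insert b' π)) ≤ 3)
    (hW2 : rk N ((((((gr N).erase b).erase b').erase f).erase e \ π).erase t) = 2) :
    rk N {e, f, t} = 3 ∧ rk N ((((((gr N).erase b).erase b').erase f).erase e).erase t) = 4 ∧
      rk N (insert b (insert b' {e, f, t})) = 5 := by
  set X := ((((gr N).erase b).erase b').erase f).erase e with hXdef
  set W := (X \ π).erase t with hWdef
  have hXE : X ⊆ ((gr N).erase b).erase b' := (erase_subset _ _).trans (erase_subset _ _)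
  have hXg : X ⊆ gr N := hXE.trans ((erase_subset _ _).trans (erase_subset _ _))
  have heE : e ∈ ((gr N).erase b).erase b' := mem_erase.2 ⟨heb', mem_erase.2 ⟨heb, he⟩⟩
  have hfE : f ∈ ((gr N).erase b).erase b' := mem_erase.2 ⟨hfb', mem_erase.2 ⟨hfb, hf⟩⟩
  have hE7c : (((gr N).erase b).erase b').card = 7 := by
    rw [card_erase_of_mem (mem_erase.2 ⟨h.2.2.1.symm, h.2.1⟩), card_erase_of_mem h.1, hn]
  have hXc : X.card = 5 := by
    rw [hXdef, card_erase_of_mem (mem_erase.2 ⟨hef, heE⟩), card_erase_of_mem hfE, hE7c]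
  have htX : t ∈ X := (mem_sdiff.1 ht).1
  have htπ : t ∉ π := (mem_sdiff.1 ht).2
  have het := he1 t htX
  have hWX : W ⊆ X := (erase_subset _ _).trans sdiff_subset
  have hWE : W ⊆ ((gr N).erase b).erase b' := hWX.trans hXE
  have heX : e ∉ X := fun h' => (mem_erase.1 h').1 rfl
  have hfX : f ∉ X := fun h' => (mem_erase.1 (mem_erase.1 h').2).1 rfl
  have htW : t ∉ W := fun h' => (mem_erase.1 h').1 rfl
  have hWc : W.card = 2 := by rw [hWdef, card_erase_of_mem ht, card_sdiff_of_subset hπ, hXc, hπ2]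
  have hπr : rk N π = 2 := by
    rw [rk_eq_card_of_subset_of_rk_eq_card (M := N) (subset_insert e π) (by
      rw [hY, card_insert_of_notMem (fun h' => heX (hπ h')), hπ2]), hπ2]
  have hXπ : X \ π = insert t W := by rw [hWdef, insert_erase ht]
  have eXt : X.erase t = π ∪ W := by
    ext w; simp only [mem_erase, mem_union, hWdef, mem_sdiff]
    constructor
    · rintro ⟨hwt, hwX⟩
      by_cases hwπ : w ∈ π
      · exact Or.inl hwπ
      · exact Or.inr ⟨hwt, hwX, hwπ⟩
    · rintro (hwπ | ⟨hwt, hwX, hwπ⟩)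
      · exact ⟨fun h' => htπ (h' ▸ hwπ), hπ hwπ⟩
      · exact ⟨hwt, hwX⟩
  have htW3 : rk N (insert t W) = 3 := by
    have := rk_eq_card_of_subset_of_rk_eq_card (M := N) (subset_insert f (insert t W)) (by
      rw [← hXπ, hYc, card_insert_of_notMem (fun h' => hfX (mem_sdiff.1 h').1), card_sdiff_of_subset hπ, hXc, hπ2])
    rw [this, card_insert_of_notMem htW, hWc]
  -- the ON set `π + e + t` (the demand plane)
  have hS₁on : rk N (insert b (insert b' (insert t (insert e π)))) = 4 := by
    have h5 : rk N (insert t (insert e π)) = rk N (insert e π) := by rw [htH, hY]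
    have := rk_insert_union_eq_of_rk_insert_eq' (N := N) (T := {b, b'}) h5
    rw [insert_t_union_bb'_eq, insert_e_union_bb'_eq] at this; rw [this, hYon]
  have hS₁E : insert t (insert e π) ⊆ ((gr N).erase b).erase b' :=
    insert_subset (hXE htX) (insert_subset heE (hπ.trans hXE))
  -- `ρ{e, f, t} = 3`
  have hefT := rk_eft_eq_three_of_plane (N := N) het hef4 htH
  refine ⟨hefT, ?_, ?_⟩
  · -- `ρ(π ∪ W) = 4`: otherwise `π` is an ON line and the swap `π + f` would be an ON target
    rw [eXt]
    by_contra hne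
    have hle : rk N (π ∪ W) ≤ 4 := by
      have := rk_mono' (M := N) (show π ∪ W ⊆ X from union_subset hπ hWX); omega
    have hI : rk N (insert b (insert b' π)) ≤ 3 := hkey (by omega)
    apply hR0
    refine ⟨?_, ?_, ?_⟩
    · have h1 : rk N (insert f π) ≤ 3 := by
        have := rk_le_card' (M := N) (insert f π)
        rw [card_insert_of_notMem (fun h' => hfX (hπ h')), hπ2] at this; exact this
      have h2 : rk N (insert f (insert e π)) ≤ rk N (insert f π) + 1 := by
        rw [insert_f_insert_e_comm]; exact rk_insert_le_add_one he (insert_subset hf (hπ.trans hXg))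
      omega
    · rw [hXπ]
      by_contra hne'
      have h1 : rk N (insert e (insert t W)) ≤ 4 := by
        have := rk_insert_le_add_one (N := N) he (insert_subset (hXg htX) (hWX.trans hXg)); omega
      have h2 : rk N (insert t W) ≤ rk N (insert e (insert t W)) := rk_mono' (M := N) (subset_insert _ _)
      have h4 : rk N (insert e (insert t W)) = 3 := by omega
      have hS'on : rk N (insert b (insert b' (insert e (insert t W)))) = 4 := by
        have h5 : rk N (insert e (insert t W)) = rk N (insert t W) := by rw [h4, htW3]
        have := rk_insert_union_eq_of_rk_insert_eq' (N := N) (T := {b, b'}) h5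
        rw [insert_t_union_bb'_eq b b' t e W, insert_e_union_bb'_eq b b' t W] at this
        rw [this, ← hXπ, hcon]
      have hU' : rk N (insert t (insert e π) ∪ insert e (insert t W)) = 4 := by
        have h5 : rk N X ≤ rk N (insert t (insert e π) ∪ insert e (insert t W)) := rk_mono' (M := N) (by
          intro w hw
          simp only [mem_union, mem_insert]
          by_cases hwt : w = t
          · exact Or.inl (Or.inl hwt)
          by_cases hwπ : w ∈ π
          · exact Or.inl (Or.inr (Or.inr hwπ))
          exact Or.inr (Or.inr (Or.inr (mem_erase.2 ⟨hwt, mem_sdiff.2 ⟨hw, hwπ⟩⟩))))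
        have h6 : rk N (insert t (insert e π) ∪ insert e (insert t W)) ≤ rk N (((gr N).erase b).erase b') :=
          rk_mono' (M := N) (union_subset hS₁E (insert_subset heE (insert_subset (hXE htX) hWE)))
        omega
      have hI' := rk_inter_le_one_of_two_on_e h hR hnle hS₁E (insert_subset heE (insert_subset (hXE htX) hWE))
        (mem_insert_of_mem (mem_insert_self _ _)) (mem_insert_self _ _) hS₁on hS'on hU'
      have h7 : rk N {e, t} ≤ rk N (insert t (insert e π) ∩ insert e (insert t W)) := rk_mono' (M := N) (by
        intro w hw; simp only [mem_insert, mem_singleton] at hw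
        rcases hw with rfl | rfl
        · exact mem_inter.2 ⟨mem_insert_of_mem (mem_insert_self _ _), mem_insert_self _ _⟩
        · exact mem_inter.2 ⟨mem_insert_self _ _, mem_insert_of_mem (mem_insert_self _ _)⟩)
      omega
    · have h1 := rk_insert_bb'_bounds h (insert_subset hfE (hπ.trans hXE))
      have h2 : rk N (insert b (insert b' (insert f π))) ≤ rk N (insert b (insert b' π)) + 1 := by
        rw [insert_bb'_f_comm]
        exact rk_insert_le_add_one hf (insert_subset h.1 (insert_subset h.2.1 (hπ.trans hXg)))
      have h3 : rk N (insert f π) = 3 := by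
        have h4 : rk N (insert f π) ≤ 3 := by
          have := rk_le_card' (M := N) (insert f π)
          rw [card_insert_of_notMem (fun h' => hfX (hπ h')), hπ2] at this; exact this
        have h5 : rk N (insert f (insert e π)) ≤ rk N (insert f π) + 1 := by
          rw [insert_f_insert_e_comm]; exact rk_insert_le_add_one he (insert_subset hf (hπ.trans hXg))
        omega
      omega
  · -- OFF: an ON `{e, f, t}` would meet the demand plane in `{e, t}`
    have hS : ({e, f, t} : Finset α) ⊆ ((gr N).erase b).erase b' := by
      intro w hw; simp only [mem_insert, mem_singleton] at hw
      rcases hw with rfl | rfl | rfl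
      · exact heE
      · exact hfE
      · exact hXE htX
    apply rk_insert_bb'_eq_five_of_not_on h hS hefT
    intro hon
    have hU : rk N ({e, f, t} ∪ insert t (insert e π)) = 4 := by
      rw [union_eft_insert_eq]
      have h1 : rk N (insert f (insert e π)) ≤ rk N (insert t (insert f (insert e π))) :=
        rk_mono' (M := N) (subset_insert _ _)
      have h2 : rk N (insert t (insert f (insert e π))) ≤ rk N (((gr N).erase b).erase b') :=
        rk_mono' (M := N) (insert_subset (hXE htX) (insert_subset hfE (insert_subset heE (hπ.trans hXE))))
      omega
    have hI := rk_inter_le_one_of_two_on_e h hR hnle hS hS₁E (mem_insert_self _ _)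
      (mem_insert_of_mem (mem_insert_self _ _)) hon hS₁on hU
    have h7 : rk N {e, t} ≤ rk N ({e, f, t} ∩ insert t (insert e π)) := rk_mono' (M := N) (by
      intro w hw; simp only [mem_insert, mem_singleton] at hw
      rcases hw with rfl | rfl
      · exact mem_inter.2 ⟨mem_insert_self _ _, mem_insert_of_mem (mem_insert_self _ _)⟩
      · exact mem_inter.2 ⟨mem_insert_of_mem (mem_insert_of_mem (mem_singleton_self _)), mem_insert_self _ _⟩)
    omega


end StarSharpD0L1

end PercRepro.Cogirth
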